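import Summits.CriticalPhenomena.PercolationContinuityZ3.Theorems.Transplant.SkelPhiWinChainFRun
import Summits.CriticalPhenomena.PercolationContinuityZ3.Theorems.Transplant.SkelPhiParaRunFrameW
import HarnessLib

/-!
# N1 (the `{±1}` node), LEVEL 1: the RUN SCHEDULES OF RECORD and the V-LEVEL ROUTE CONTAINMENTS — `xRunSched/yRunSched n ℓ h (v) R′ q N : ScheduleN`
# (the window-unit runs `xPrmW/yPrmW` as planar schedules along axis `0`, sign `1`, origin `0`: the run direction `σ` lives in the frame
# `runX/runY φ c₀ n h σ`), their cores/regions unfolded, `runX/runY` of the origin, and the two facts the route datum needs from LEVEL 1: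
# the LINK REGION `pgramPrism t n h (3ℓ) R` of a seed centre `t` in the `R′`-enlarged core `k` is read into `region k`, and the STEERED PIECE
# (`pgSideHalfW … σ (σ·τₖ)` / `pgTopPieceW … σ τₖ v`, `τₖ =` the schedule's steering sign at `t`) into `core (k+1)`

builds on p205010 (kernel theorem, internal audit signed; external expert review pending) — nothing in this file uses p205010; nothing here is a
claim about the open node `SamePDropOfSkeletonNeg`.
Lane `prim-bschramm`, seat `prim-bschramm-p1` (gen 11; NEG-SCOPE v1.1 §5 / P5-R2; recipe `HOME/prim-bschramm-p1/N1-RUN-RECORDS.md` addendum 13:10Z);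
helper file (`--supports stmt-CriticalPhenomena-4575 --as helper`).
* §1 **`xRunSched`**, **`yRunSched`**, `xRunSched_N/_R'`, `yRunSched_N/_R'`, `runX_origin`, `runY_origin`, **`mem_xRunSched_enl_iff`** / `mem_yRunSched_enl_iff`
  (the `R′`-enlarged core in run coordinates), `mem_xRunSched_region_iff`, `mem_xRunSched_core_iff` (+ `y`);
* §2 x-runs: **`runX_mem_region_of_link`** (`w ∈ pgramPrism t n h (3ℓ) R`, `runX t ∈` enlarged core `k` ⇒ `runX w ∈ region k`),
  **`runX_mem_core_succ_of_piece`** (`w ∈ pgSideHalfW t n h ℓ R σ (σ·steer)` ⇒ `runX w ∈ core (k+1)`);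
* §3 y′-runs: **`runY_mem_region_of_link`**, **`runY_mem_core_succ_of_piece`** (`w ∈ pgTopPieceW t n h ℓ R σ steer v`);
* §4 window form: `mem_Win_region_of_link`, `mem_Win_core_succ_of_piece` (+ `y`) — add the window radius condition `w ∈ graphBall c₀ R₀`.
[cite: MartineauTassion2017, §4.3 Lemma 4.2 (piece choice by position)] [cite: KozmaNitzan2024, §4 Lemma 11 (pp. 22–23)]
-/

noncomputable section

namespace Summit.CriticalPhenomena.PercolationContinuityZ3.Theorems.Transplant

namespace Skelφ

open Literature.Probability.Percolation Literature.Probability.LatticeModels SimpleGraph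
open Literature.Barriers.CriticalPhenomena (graphBall)
open Literature.Probability.Percolation.KozmaNitzan.Cells (oth)
open ChainPlanar ChainPara

variable {V : Type}

/-! ## §1 The run schedules of record -/

/-- **The x-run schedule** (window units): `xPrmW n ℓ h R′ q N` along axis `0`, sign `1`, planar origin `0`. [this work] -/
def xRunSched (n ℓ : ℕ) (h : ℤ) (R' q N : ℕ) : ScheduleN :=
  (xPrmW n ℓ h R' q N).scheduleN 0 (σ := 1) (Or.inl rfl) 0 (xPrmW_ok n ℓ h R' q N) (xPrmW_eb n ℓ h R' q N)

/-- **The y′-run schedule** (window units): `yPrmW n ℓ h v R′ q N` along axis `0`, sign `1`, planar origin `0` (`1 ≤ n`, `|v| ≤ n`, layer inequality). [this work] -/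
def yRunSched {n ℓ : ℕ} {h v : ℤ} (hn : 1 ≤ n) (hv : |v| ≤ n) (hlay : (n + h.natAbs : ℕ) ≤ (n : ℤ) * ℓ + 1) (R' q N : ℕ) : ScheduleN :=
  (yPrmW n ℓ h v R' q N).scheduleN 0 (σ := 1) (Or.inl rfl) 0 (yPrmW_ok hn hv hlay R' q N) (yPrmW_eb n ℓ h v R' q N)

/-- The x-run schedule's length and radius. [folklore] -/
theorem xRunSched_N_R' (n ℓ : ℕ) (h : ℤ) (R' q N : ℕ) : (xRunSched n ℓ h R' q N).N = N ∧ (xRunSched n ℓ h R' q N).R' = R' := ⟨rfl, rfl⟩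

/-- The y′-run schedule's length and radius. [folklore] -/
theorem yRunSched_N_R' {n ℓ : ℕ} {h v : ℤ} (hn : 1 ≤ n) (hv : |v| ≤ n) (hlay : (n + h.natAbs : ℕ) ≤ (n : ℤ) * ℓ + 1) (R' q N : ℕ) :
    (yRunSched hn hv hlay R' q N).N = N ∧ (yRunSched hn hv hlay R' q N).R' = R' := ⟨rfl, rfl⟩

/-- The run origin sits at the planar origin of the x-frame. [folklore] -/
@[simp] theorem runX_origin (φ : V → Site 2) (c₀ : V) (n : ℕ) (h σ : ℤ) : runX φ c₀ n h σ c₀ = 0 := by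
  funext i; fin_cases i <;> simp [runX, relCoord_apply, shearCoord_apply]

/-- The run origin sits at the planar origin of the y′-frame. [folklore] -/
@[simp] theorem runY_origin (φ : V → Site 2) (c₀ : V) (n : ℕ) (h σ : ℤ) : runY φ c₀ n h σ c₀ = 0 := by
  funext i; fin_cases i <;> simp [runY, relCoord_apply, shearCoord_apply]

/-- `oth 0 = 1`. [folklore] -/
theorem oth_zero : oth (0 : Fin 2) = 1 := rfl

/-- Membership in the `R′`-enlarged core `k` of a run schedule along axis `0`, sign `1`, origin `0`, in run coordinates. [folklore] -/
theorem mem_scheduleN_enl_iff {P : RunPrm} (hP : RunOK P) (heb : P.eb = P.ea) {k : ℕ} {y : Site 2} :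
    y ∈ Finset.Icc ((P.scheduleN 0 (σ := 1) (Or.inl rfl) 0 hP heb).lo k - (((P.scheduleN 0 (σ := 1) (Or.inl rfl) 0 hP heb).R' : ℕ) : Site 2))
        ((P.scheduleN 0 (σ := 1) (Or.inl rfl) 0 hP heb).hi k + (((P.scheduleN 0 (σ := 1) (Or.inl rfl) 0 hP heb).R' : ℕ) : Site 2)) ↔
      P.InEnl k (y 0) (y 1) := by
  show y ∈ Finset.Icc (dLo 0 1 0 (P.aLo k) (P.aHi k) (P.bLo k) (P.bHi k) - ((P.ea : ℕ) : Site 2))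
      (dHi 0 1 0 (P.aLo k) (P.aHi k) (P.bLo k) (P.bHi k) + ((P.ea : ℕ) : Site 2)) ↔ _
  rw [dBox_enlarge (Or.inl rfl), RunPrm.mem_enlarge_iff (Or.inl rfl) heb]
  simp [oth_zero]

/-- Membership in region `k` of such a run schedule, in run coordinates. [folklore] -/
theorem mem_scheduleN_region_iff {P : RunPrm} (hP : RunOK P) (heb : P.eb = P.ea) {k : ℕ} {y : Site 2} :
    y ∈ (P.scheduleN 0 (σ := 1) (Or.inl rfl) 0 hP heb).region k ↔ P.InRegion k (y 0) (y 1) := by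
  rw [RunPrm.scheduleN_region, RunPrm.mem_pregion_iff (Or.inl rfl)]; simp [oth_zero]

/-- Membership in core `k` of such a run schedule, in run coordinates. [folklore] -/
theorem mem_scheduleN_core_iff {P : RunPrm} (hP : RunOK P) (heb : P.eb = P.ea) {k : ℕ} {y : Site 2} :
    y ∈ (P.scheduleN 0 (σ := 1) (Or.inl rfl) 0 hP heb).core k ↔ P.InCore k (y 0) (y 1) := by
  rw [RunPrm.scheduleN_core, RunPrm.mem_pcore_iff (Or.inl rfl)]; simp [oth_zero]

/-! ## §2 x-runs: link region into the region, steered side half into the next core -/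

variable {G : SimpleGraph V} {φ : V → Site 2}

/-- **The link region of a seed centre in the enlarged core is read into the region** (x-run): `runX t ∈ Icc (lo k − R′) (hi k + R′)` and
`w ∈ pgramPrism t n h (3ℓ) R` give `runX w ∈ region k`. [cite: KozmaNitzan2024, §4 Lemma 11 (p. 22)] -/
theorem runX_mem_region_of_link {n : ℕ} (hn : 1 ≤ n) (c₀ : V) (h : ℤ) {σ : ℤ} (hσ : σ = 1 ∨ σ = -1) {ℓ : ℕ} (R' q N : ℕ) {k : ℕ} {t w : V} {R : ℕ}
    (ht : runX φ c₀ n h σ t ∈ Finset.Icc ((xRunSched n ℓ h R' q N).lo k - (((xRunSched n ℓ h R' q N).R' : ℕ) : Site 2))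
      ((xRunSched n ℓ h R' q N).hi k + (((xRunSched n ℓ h R' q N).R' : ℕ) : Site 2)))
    (hw : w ∈ pgramPrism G φ t n h (3 * ℓ) R) : runX φ c₀ n h σ w ∈ (xRunSched n ℓ h R' q N).region k := by
  have ht' := (mem_scheduleN_enl_iff (xPrmW_ok n ℓ h R' q N) (xPrmW_eb n ℓ h R' q N)).1 ht
  obtain ⟨h0, h1⟩ := link_runX hn c₀ h hσ hw R' q N
  exact (mem_scheduleN_region_iff _ _).2 (RunPrm.inRegion_of_link ht' h0 h1)

/-- **The steered side half is read into the next core** (x-run): with `τₖ := steer k (runX t 1)` (the x-run schedule's steering sign at the seed centre),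
every `w ∈ pgSideHalfW t n h ℓ R σ (σ·τₖ)` has `runX w ∈ core (k+1)`. [cite: MartineauTassion2017, §4.3 Lemma 4.2] [cite: KozmaNitzan2024, §4 Lemma 11 (pp. 22–23)] -/
theorem runX_mem_core_succ_of_piece [G.LocallyFinite] {n : ℕ} (hn : 1 ≤ n) (c₀ : V) (h : ℤ) {σ : ℤ} (hσ : σ = 1 ∨ σ = -1) {ℓ : ℕ} (R' q N : ℕ)
    {k : ℕ} {t w : V} {R : ℕ}
    (ht : runX φ c₀ n h σ t ∈ Finset.Icc ((xRunSched n ℓ h R' q N).lo k - (((xRunSched n ℓ h R' q N).R' : ℕ) : Site 2))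
      ((xRunSched n ℓ h R' q N).hi k + (((xRunSched n ℓ h R' q N).R' : ℕ) : Site 2)))
    (hw : w ∈ pgSideHalfW G φ t n h ℓ R σ (σ * (xPrmW n ℓ h R' q N).steer k (runX φ c₀ n h σ t 1))) :
    runX φ c₀ n h σ w ∈ (xRunSched n ℓ h R' q N).core (k + 1) := by
  set τ₀ := (xPrmW n ℓ h R' q N).steer k (runX φ c₀ n h σ t 1) with hτ₀
  have hτ₀' : τ₀ = 1 ∨ τ₀ = -1 := (xPrmW n ℓ h R' q N).steer_eq_or k _
  have hστ : σ * τ₀ = 1 ∨ σ * τ₀ = -1 := by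
    rcases hσ with rfl | rfl <;> rcases hτ₀' with h1 | h1 <;> simp [h1]
  have hσσ : σ * σ = 1 := by rcases hσ with h1 | h1 <;> simp [h1]
  have ht' := (mem_scheduleN_enl_iff (xPrmW_ok n ℓ h R' q N) (xPrmW_eb n ℓ h R' q N)).1 ht
  obtain ⟨h0, hpc⟩ := landing_runX_W hn c₀ h hσ hστ hw R' q N
  have hpiece : (xPrmW n ℓ h R' q N).InPiece τ₀ (runX φ c₀ n h σ w 1 - runX φ c₀ n h σ t 1 - (xPrmW n ℓ h R' q N).d) := by
    have e : σ * (σ * τ₀) = τ₀ := by rw [← mul_assoc, hσσ, one_mul]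
    rw [e] at hpc; exact hpc
  refine (mem_scheduleN_core_iff _ _).2 (RunPrm.inCore_succ_of_landing (xPrmW_ok n ℓ h R' q N) ht' ?_ ?_ hpiece)
  · rw [h0]; exact le_rfl
  · rw [h0]; exact le_rfl

/-! ## §3 y′-runs: link region into the region, steered top piece into the next core -/

/-- **The link region of a seed centre in the enlarged core is read into the region** (y′-run). [cite: KozmaNitzan2024, §4 Lemma 11 (p. 22)] -/
theorem runY_mem_region_of_link {n ℓ : ℕ} {h v : ℤ} (hn : 1 ≤ n) (hv : |v| ≤ n) (hlay : (n + h.natAbs : ℕ) ≤ (n : ℤ) * ℓ + 1) (c₀ : V) {σ : ℤ}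
    (hσ : σ = 1 ∨ σ = -1) (R' q N : ℕ) {k : ℕ} {t w : V} {R : ℕ}
    (ht : runY φ c₀ n h σ t ∈ Finset.Icc ((yRunSched hn hv hlay R' q N).lo k - (((yRunSched hn hv hlay R' q N).R' : ℕ) : Site 2))
      ((yRunSched hn hv hlay R' q N).hi k + (((yRunSched hn hv hlay R' q N).R' : ℕ) : Site 2)))
    (hw : w ∈ pgramPrism G φ t n h (3 * ℓ) R) : runY φ c₀ n h σ w ∈ (yRunSched hn hv hlay R' q N).region k := by
  have ht' := (mem_scheduleN_enl_iff (yPrmW_ok hn hv hlay R' q N) (yPrmW_eb n ℓ h v R' q N)).1 ht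
  obtain ⟨h0, h1⟩ := link_runY hn c₀ h hσ hw v R' q N
  exact (mem_scheduleN_region_iff _ _).2 (RunPrm.inRegion_of_link ht' h0 h1)

/-- **The steered top piece is read into the next core** (y′-run): with `τₖ := steer k (runY t 1)`, every `w ∈ pgTopPieceW t n h ℓ R σ τₖ v` has
`runY w ∈ core (k+1)`. [cite: MartineauTassion2017, §4.3 Lemma 4.2] [cite: KozmaNitzan2024, §4 Lemma 11 (pp. 22–23)] -/
theorem runY_mem_core_succ_of_piece [G.LocallyFinite] {n ℓ : ℕ} {h v : ℤ} (hn : 1 ≤ n) (hv : |v| ≤ n) (hlay : (n + h.natAbs : ℕ) ≤ (n : ℤ) * ℓ + 1)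
    (c₀ : V) {σ : ℤ} (hσ : σ = 1 ∨ σ = -1) (R' q N : ℕ) {k : ℕ} {t w : V} {R : ℕ}
    (ht : runY φ c₀ n h σ t ∈ Finset.Icc ((yRunSched hn hv hlay R' q N).lo k - (((yRunSched hn hv hlay R' q N).R' : ℕ) : Site 2))
      ((yRunSched hn hv hlay R' q N).hi k + (((yRunSched hn hv hlay R' q N).R' : ℕ) : Site 2)))
    (hw : w ∈ pgTopPieceW G φ t n h ℓ R σ ((yPrmW n ℓ h v R' q N).steer k (runY φ c₀ n h σ t 1)) v) :
    runY φ c₀ n h σ w ∈ (yRunSched hn hv hlay R' q N).core (k + 1) := by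
  set τ₀ := (yPrmW n ℓ h v R' q N).steer k (runY φ c₀ n h σ t 1) with hτ₀
  have hτ₀' : τ₀ = 1 ∨ τ₀ = -1 := (yPrmW n ℓ h v R' q N).steer_eq_or k _
  have ht' := (mem_scheduleN_enl_iff (yPrmW_ok hn hv hlay R' q N) (yPrmW_eb n ℓ h v R' q N)).1 ht
  obtain ⟨⟨h0, h1⟩, hpc⟩ := landing_runY_W hn c₀ h hσ hτ₀' hw R' q N
  exact (mem_scheduleN_core_iff _ _).2 (RunPrm.inCore_succ_of_landing (yPrmW_ok hn hv hlay R' q N) ht' h0 h1 hpc)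

/-! ## §4 Window form -/

/-- **Link region into the region window** (x-run): with the window radius covering the link region. [cite: KozmaNitzan2024, §4 Lemma 11 (p. 22)] -/
theorem mem_Win_region_of_link [G.LocallyFinite] {n : ℕ} (hn : 1 ≤ n) (c₀ : V) (h : ℤ) {σ : ℤ} (hσ : σ = 1 ∨ σ = -1) {ℓ : ℕ} (R' q N : ℕ)
    {k : ℕ} {t w : V} {R R₀ : ℕ}
    (ht : runX φ c₀ n h σ t ∈ Finset.Icc ((xRunSched n ℓ h R' q N).lo k - (((xRunSched n ℓ h R' q N).R' : ℕ) : Site 2))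
      ((xRunSched n ℓ h R' q N).hi k + (((xRunSched n ℓ h R' q N).R' : ℕ) : Site 2)))
    (hw : w ∈ pgramPrism G φ t n h (3 * ℓ) R) (hwR : w ∈ graphBall G c₀ R₀) :
    w ∈ Win G (runX φ c₀ n h σ) c₀ ((xRunSched n ℓ h R' q N).region k) R₀ :=
  (mem_Win G _).2 ⟨hwR, runX_mem_region_of_link hn c₀ h hσ R' q N ht hw⟩

/-- **Steered side half into the next core's window** (x-run). [cite: KozmaNitzan2024, §4 Lemma 11 (pp. 22–23)] -/
theorem mem_Win_core_succ_of_piece [G.LocallyFinite] {n : ℕ} (hn : 1 ≤ n) (c₀ : V) (h : ℤ) {σ : ℤ} (hσ : σ = 1 ∨ σ = -1) {ℓ : ℕ} (R' q N : ℕ)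
    {k : ℕ} {t w : V} {R R₀ : ℕ}
    (ht : runX φ c₀ n h σ t ∈ Finset.Icc ((xRunSched n ℓ h R' q N).lo k - (((xRunSched n ℓ h R' q N).R' : ℕ) : Site 2))
      ((xRunSched n ℓ h R' q N).hi k + (((xRunSched n ℓ h R' q N).R' : ℕ) : Site 2)))
    (hw : w ∈ pgSideHalfW G φ t n h ℓ R σ (σ * (xPrmW n ℓ h R' q N).steer k (runX φ c₀ n h σ t 1))) (hwR : w ∈ graphBall G c₀ R₀) :
    w ∈ Win G (runX φ c₀ n h σ) c₀ ((xRunSched n ℓ h R' q N).core (k + 1)) R₀ :=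
  (mem_Win G _).2 ⟨hwR, runX_mem_core_succ_of_piece hn c₀ h hσ R' q N ht hw⟩

/-- **Link region into the region window** (y′-run). [cite: KozmaNitzan2024, §4 Lemma 11 (p. 22)] -/
theorem mem_Win_region_of_link_y [G.LocallyFinite] {n ℓ : ℕ} {h v : ℤ} (hn : 1 ≤ n) (hv : |v| ≤ n) (hlay : (n + h.natAbs : ℕ) ≤ (n : ℤ) * ℓ + 1)
    (c₀ : V) {σ : ℤ} (hσ : σ = 1 ∨ σ = -1) (R' q N : ℕ) {k : ℕ} {t w : V} {R R₀ : ℕ}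
    (ht : runY φ c₀ n h σ t ∈ Finset.Icc ((yRunSched hn hv hlay R' q N).lo k - (((yRunSched hn hv hlay R' q N).R' : ℕ) : Site 2))
      ((yRunSched hn hv hlay R' q N).hi k + (((yRunSched hn hv hlay R' q N).R' : ℕ) : Site 2)))
    (hw : w ∈ pgramPrism G φ t n h (3 * ℓ) R) (hwR : w ∈ graphBall G c₀ R₀) :
    w ∈ Win G (runY φ c₀ n h σ) c₀ ((yRunSched hn hv hlay R' q N).region k) R₀ :=
  (mem_Win G _).2 ⟨hwR, runY_mem_region_of_link hn hv hlay c₀ hσ R' q N ht hw⟩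

/-- **Steered top piece into the next core's window** (y′-run). [cite: KozmaNitzan2024, §4 Lemma 11 (pp. 22–23)] -/
theorem mem_Win_core_succ_of_piece_y [G.LocallyFinite] {n ℓ : ℕ} {h v : ℤ} (hn : 1 ≤ n) (hv : |v| ≤ n) (hlay : (n + h.natAbs : ℕ) ≤ (n : ℤ) * ℓ + 1)
    (c₀ : V) {σ : ℤ} (hσ : σ = 1 ∨ σ = -1) (R' q N : ℕ) {k : ℕ} {t w : V} {R R₀ : ℕ}
    (ht : runY φ c₀ n h σ t ∈ Finset.Icc ((yRunSched hn hv hlay R' q N).lo k - (((yRunSched hn hv hlay R' q N).R' : ℕ) : Site 2))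
      ((yRunSched hn hv hlay R' q N).hi k + (((yRunSched hn hv hlay R' q N).R' : ℕ) : Site 2)))
    (hw : w ∈ pgTopPieceW G φ t n h ℓ R σ ((yPrmW n ℓ h v R' q N).steer k (runY φ c₀ n h σ t 1)) v) (hwR : w ∈ graphBall G c₀ R₀) :
    w ∈ Win G (runY φ c₀ n h σ) c₀ ((yRunSched hn hv hlay R' q N).core (k + 1)) R₀ :=
  (mem_Win G _).2 ⟨hwR, runY_mem_core_succ_of_piece hn hv hlay c₀ hσ R' q N ht hw⟩

end Skelφ

end Summit.CriticalPhenomena.PercolationContinuityZ3.Theorems.Transplant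

end
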